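import Summits.QuantumFields.BalabanUV.Beta.SymAveragingHessianCounts

/-!
# `BalabanUV.Beta.D1BFx.SymHessTablePairMass` — road «BF-x» for binder row D1, slot (K) ∕ junction (J1), PART 24 HEAD rows with the multiplier-leg vertex
# `V_H = vertexOfM K₀ n (symHessFFAt ρ_c n)`, «H-TABLE-MASS» PART A: **THE PAIR `ℓ¹` MASS OF an1's SYMMETRISED AVERAGING HESSIAN TABLE IS
# `Σ_{f ∈ S₁} Σ_{f′ ∈ S₂} |h^ρ_sym_{(μ,y)}(f, f′)| ≤ 2ℓ²` FOR ALL FINITE BOND SETS — THE SAME NUMBER THAT BOUNDS ONE ENTRY (an1's `abs_symHessKerAt_le`)**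

HONEST DEPENDENCY (cell records, verbatim): «continuum YM on T⁴ ⇐ BetaPertH ∧ nine spine estimates (0/9 proved); BetaPertH ⇐ (D1) ∧ (D4) ∧
CAP+tail; G-an2-4 gates asym, D1 and NE2/3/4.»  HONEST FRAMING (cell contract, verbatim): «discharging `BetaPertH` makes Bałaban's UV stability
UNCONDITIONAL — a real constructive-QFT result; it is NOT the continuum limit and NOT the Clay problem.»  THIS MODULE DISCHARGES NOTHING of the
wall: [folklore] list and `Finset` bookkeeping BY NAME over an1's LANDED count words — `SymAveragingHessianCountsWords ∕ …Bounds ∕ …Counts` (`symHessCountAt =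
symWedgeCountAt + d!·(symLin·c − …) + (d!)²L^d·wedge(c)`, `loopPAt ∕ gammaPAt ∕ loopPAt_map ∕ gammaPAt_map` (naturality in the coefficients), `lettersIn_loopPAt ∕
lettersIn_gammaPAt`, `loopPAt_length_le_ell ∕ gammaPAt_length_le_ell`, `symHessKerAt = count ∕ (2(d!)²L^d)`), lit `AveragingHessianKernels.wedge ∕ wedge_cons ∕ fl ∕ bg ∕ δ1 ∕
pairForm ∕ mapForm ∕ LettersIn ∕ lettersIn_cSegAt ∕ segUp_map`.  No definition (the «universal indicator form» is the lambda `fun κ x ↦ δ1 (κ, x)`; evaluations at a bond are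
`Pi.evalAddMonoidHom` terms), no `def … : Prop`, nothing cited, NO printed hypothesis, 0 sorry.  A TABLE LETTER: it prices NO word and proves NO (1.22) row; 0 root-level
binders of row D1 discharged (hW ∕ hR-sockets ∕ hSX-socket ∕ D1Tel ∕ D1Rep = 0); (J1) ONE OPEN ROW; (K) NOT closed; NOT D1, NEVER «G-an2-4 closed», NOT `BetaPertH`, NOT continuum,
NOT Clay.

ABSOLUTE RULE (cell charter, verbatim): «No internally-minted statement may enter as a cited fact. Every hypothesis is either kernel-proved in
this package or a verbatim quotation of a PUBLISHED theorem with page reference. The manuscript(s) under audit are NOT citable for their own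
disputed steps — they are the thing under adjudication; programme-internal (2001/route/tribunal) claims are never citable.»

WHY (this lineage's g61 C′: «the `Zl`-route prices a finite-range table at n-uniform `δ ≍ 1∕n` with `≍ n⁸` — a finite-support count is the sharper letter»; d1-leaf-03 g33
TT27b's `M_H(n)` reads the H-table through an1's SUP letter `vertexFamily_symHessFFAt` (`2ℓ²` PER ENTRY) and two lattice volumes at a fine rate: `≍ n²·CΦ`).  an1's entry
bound `|h_sym(f,f′)| ≤ 2ℓ²` comes from `|HESS⁰⁴| ≤ 4(d!)²L^dℓ²`: `L^d` base points × `(d!)²` order pairs × the wedge of a loop of `≤ ℓ` letters.  But the wedge of ONE loop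
SUMMED over all bond pairs `(f, f′)` is ALSO `≤ ℓ²`: each of the letter pairs of the loop lands on at most one `(f, f′)` per orientation (§1, `wedge_cons` induction through the
universal indicator form and `loopPAt_map`); the linear × straight words and the straight wedge sum the same way.  So the PAIR MASS obeys the bound of ONE entry.
PART B (`D1BFx/SymHessTableMass`) turns this into the `hMs ∕ hMm` sockets of g61 C′ `mass_blk_vertexOfM_K₀_le` and the (M-b) block masses of `V_H` with NET `n⁻⁸ × 2·ell(4,n)² × CΦ`.

CONTENT.
* §1 [folklore, generic `d`] letter-word masses: `sum_abs_δ1_le_one`, **`sum_abs_sum_eval_le_length`** (`Σ_{f∈S} |Σ_{q∈l} q f| ≤ |l|` for words of letters `±δ1 g`),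
  **`sum_sum_abs_wedge_le_sq`** (`Σ_{f∈S₁}Σ_{f′∈S₂} |wedge (l read at (f,f′))| ≤ |l|²` for words of letters `±(δ1 g, δ1 g)`).
* §2 [folklore] the universal indicator form: `δ1_eq_mapForm_eval`, `pairForm_δ1_eq_mapForm_eval`, `letters_of_lettersIn_univ[_pair]`, **`sum_sum_abs_wedge_loopPAt_le`**
  (`≤ ℓ²`), **`sum_sum_abs_wedge_segUp_le`** (`≤ L²`).
* §3 [folklore, box root, `1 ≤ L`]: `sum_sum_abs_symWedgeCountAt_le` (`≤ (d!)²·(L^d·ℓ²)`), `sum_abs_symLinCountAt_le` (`≤ d!·(L^d·ℓ)`), `sum_abs_cCountAt_le` (`≤ L`),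
  **`sum_sum_abs_symHessCountAt_le`** (`≤ 4·(d!)²·L^d·ℓ²`), **`sum_sum_abs_symHessKerAt_le`** (`Σ_{f∈S₁}Σ_{f′∈S₂} |symHessKerAt (toSite r) L μ y f f′| ≤ 2·ℓ²`).
NOT HERE (honest): the packed table and `V_H` (PART B); any row; the analogous pair masses of an1's border ∕ mixed tables (same words — on word).
Unit `b2b-balaban-gan24-formalise-leaf-05` (gen 63), G-an2-4 swarm leaf prover 05, road «BF-x» supplier; INTENT-4 «H-TABLE-MASS» (journal).  Not in print; our bookkeeping.
No existing file touched.
-/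

noncomputable section

open Finset
open scoped BigOperators Nat
open Literature.MathematicalPhysics.QuantumFieldTheory
open Literature.MathematicalPhysics.QuantumFieldTheory.Balaban1983to89
open Literature.MathematicalPhysics.QuantumFieldTheory.Balaban1983to89.Beta
open Literature.MathematicalPhysics.QuantumFieldTheory.Balaban1983to89.Beta.AffineAveraging
open Literature.MathematicalPhysics.QuantumFieldTheory.Balaban1983to89.Beta.TransportedContourVariables
open Literature.MathematicalPhysics.QuantumFieldTheory.Balaban1983to89.Beta.AveragingHessianKernels

namespace Summit.QuantumFields.BalabanUV.Beta.D1BFx.SymHessTablePairMass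

variable {d : ℕ}

/-! ## §1 Pair masses of letter words: a word of `k` signed bond letters has `Σ_{f,f′} |wedge| ≤ k²` and `Σ_f |sum| ≤ k` -/

/-- [folklore] A signed bond letter `±δ1 g`, read at the bonds of a finite set, has total mass `≤ 1`. -/
theorem sum_abs_δ1_le_one (S : Finset (Bond d)) (g : Bond d) : ∑ f ∈ S, |δ1 g f.1 f.2| ≤ 1 := by
  classical
  have h : ∀ f ∈ S, |δ1 g f.1 f.2| = if f = g then (1 : ℤ) else 0 := by
    intro f _
    simp only [δ1_apply, Prod.mk.eta]
    split_ifs <;> simp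
  rw [Finset.sum_congr rfl h, Finset.sum_ite_eq']
  split_ifs <;> norm_num

/-- [folklore] **SINGLE MASS OF A LETTER WORD**: if every letter of `l : List (Form1 d ℤ)` is `±δ1 g` for some bond `g`, then for every finite bond set `S`,
`Σ_{f ∈ S} |Σ_{q ∈ l} q f| ≤ l.length`. -/
theorem sum_abs_sum_eval_le_length (S : Finset (Bond d)) :
    ∀ (l : List (Form1 d ℤ)), (∀ q ∈ l, ∃ g : Bond d, q = δ1 g ∨ q = -δ1 g) →
      ∑ f ∈ S, |(l.map fun q => q f.1 f.2).sum| ≤ (l.length : ℤ)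
  | [], _ => by simp
  | q :: l, h => by
    have hq : ∃ g : Bond d, q = δ1 g ∨ q = -δ1 g := h q (by simp)
    have hl : ∀ q' ∈ l, ∃ g : Bond d, q' = δ1 g ∨ q' = -δ1 g := fun q' hq' => h q' (by simp [hq'])
    have ih := sum_abs_sum_eval_le_length S l hl
    obtain ⟨g, hg⟩ := hq
    have hq1 : ∑ f ∈ S, |q f.1 f.2| ≤ 1 := by
      rcases hg with rfl | rfl
      · exact sum_abs_δ1_le_one S g
      · simpa only [Pi.neg_apply, abs_neg] using sum_abs_δ1_le_one S g
    simp only [List.map_cons, List.sum_cons, List.length_cons, Nat.cast_succ]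
    calc ∑ f ∈ S, |q f.1 f.2 + (l.map fun q => q f.1 f.2).sum|
        ≤ ∑ f ∈ S, (|q f.1 f.2| + |(l.map fun q => q f.1 f.2).sum|) := Finset.sum_le_sum fun f _ => abs_add_le _ _
      _ = ∑ f ∈ S, |q f.1 f.2| + ∑ f ∈ S, |(l.map fun q => q f.1 f.2).sum| := Finset.sum_add_distrib
      _ ≤ 1 + (l.length : ℤ) := add_le_add hq1 ih
      _ = (l.length : ℤ) + 1 := add_comm _ _

/-- [folklore] **PAIR MASS OF THE WEDGE OF A LETTER WORD**: if every letter of `l : List (Form1 d ℤ × Form1 d ℤ)` is `±(δ1 g, δ1 g)` for some bond `g`, then for all finite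
bond sets `S₁, S₂`, `Σ_{f ∈ S₁} Σ_{f′ ∈ S₂} |wedge (l.map (q ↦ (q.1 f, q.2 f′)))| ≤ l.length²` — each of the `C(k,2)` letter pairs `(i, j)` contributes to at most
one `(f, f′)` per orientation. -/
theorem sum_sum_abs_wedge_le_sq (S₁ S₂ : Finset (Bond d)) :
    ∀ (l : List (Form1 d ℤ × Form1 d ℤ)), (∀ q ∈ l, ∃ g : Bond d, q = (δ1 g, δ1 g) ∨ q = (-δ1 g, -δ1 g)) →
      ∑ f ∈ S₁, ∑ f' ∈ S₂, |wedge (l.map fun q => (q.1 f.1 f.2, q.2 f'.1 f'.2))| ≤ (l.length : ℤ) ^ 2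
  | [], _ => by simp
  | q :: l, h => by
    have hq : ∃ g : Bond d, q = (δ1 g, δ1 g) ∨ q = (-δ1 g, -δ1 g) := h q (by simp)
    have hl : ∀ q' ∈ l, ∃ g : Bond d, q' = (δ1 g, δ1 g) ∨ q' = (-δ1 g, -δ1 g) := fun q' hq' => h q' (by simp [hq'])
    have ih := sum_sum_abs_wedge_le_sq S₁ S₂ l hl
    -- the two component words of `l` are letter words
    have hl1 : ∀ p ∈ l.map Prod.fst, ∃ g : Bond d, p = δ1 g ∨ p = -δ1 g := by
      intro p hp
      obtain ⟨q', hq', rfl⟩ := List.mem_map.1 hp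
      obtain ⟨g, hg⟩ := hl q' hq'
      exact ⟨g, by rcases hg with rfl | rfl <;> simp⟩
    have hl2 : ∀ p ∈ l.map Prod.snd, ∃ g : Bond d, p = δ1 g ∨ p = -δ1 g := by
      intro p hp
      obtain ⟨q', hq', rfl⟩ := List.mem_map.1 hp
      obtain ⟨g, hg⟩ := hl q' hq'
      exact ⟨g, by rcases hg with rfl | rfl <;> simp⟩
    obtain ⟨g, hg⟩ := hq
    have hq1 : ∑ f ∈ S₁, |q.1 f.1 f.2| ≤ 1 := by
      rcases hg with rfl | rfl
      · exact sum_abs_δ1_le_one S₁ g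
      · simpa only [Pi.neg_apply, abs_neg] using sum_abs_δ1_le_one S₁ g
    have hq2 : ∑ f' ∈ S₂, |q.2 f'.1 f'.2| ≤ 1 := by
      rcases hg with rfl | rfl
      · exact sum_abs_δ1_le_one S₂ g
      · simpa only [Pi.neg_apply, abs_neg] using sum_abs_δ1_le_one S₂ g
    -- the `fl` ∕ `bg` sums of the mapped tail are the evaluated component words
    have hfl : ∀ f f' : Bond d, (fl (l.map fun q => (q.1 f.1 f.2, q.2 f'.1 f'.2))).sum = ((l.map Prod.snd).map fun p => p f'.1 f'.2).sum := by
      intro f f'; simp [fl, List.map_map, Function.comp_def]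
    have hbg : ∀ f f' : Bond d, (bg (l.map fun q => (q.1 f.1 f.2, q.2 f'.1 f'.2))).sum = ((l.map Prod.fst).map fun p => p f.1 f.2).sum := by
      intro f f'; simp [bg, List.map_map, Function.comp_def]
    have hA : ∑ f' ∈ S₂, |((l.map Prod.snd).map fun p => p f'.1 f'.2).sum| ≤ (l.length : ℤ) := by
      simpa using sum_abs_sum_eval_le_length S₂ (l.map Prod.snd) hl2
    have hB : ∑ f ∈ S₁, |((l.map Prod.fst).map fun p => p f.1 f.2).sum| ≤ (l.length : ℤ) := by
      simpa using sum_abs_sum_eval_le_length S₁ (l.map Prod.fst) hl1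
    have hlen : (0 : ℤ) ≤ l.length := by positivity
    have hAn : 0 ≤ ∑ f' ∈ S₂, |((l.map Prod.snd).map fun p => p f'.1 f'.2).sum| := Finset.sum_nonneg fun _ _ => abs_nonneg _
    have hq2n : 0 ≤ ∑ f' ∈ S₂, |q.2 f'.1 f'.2| := Finset.sum_nonneg fun _ _ => abs_nonneg _
    simp only [List.map_cons, wedge_cons, List.length_cons, Nat.cast_succ]
    calc ∑ f ∈ S₁, ∑ f' ∈ S₂, |wedge (l.map fun q => (q.1 f.1 f.2, q.2 f'.1 f'.2))
            + (q.1 f.1 f.2 * (fl (l.map fun q => (q.1 f.1 f.2, q.2 f'.1 f'.2))).sum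
              - q.2 f'.1 f'.2 * (bg (l.map fun q => (q.1 f.1 f.2, q.2 f'.1 f'.2))).sum)|
        ≤ ∑ f ∈ S₁, ∑ f' ∈ S₂, (|wedge (l.map fun q => (q.1 f.1 f.2, q.2 f'.1 f'.2))|
            + (|q.1 f.1 f.2| * |((l.map Prod.snd).map fun p => p f'.1 f'.2).sum|
              + |((l.map Prod.fst).map fun p => p f.1 f.2).sum| * |q.2 f'.1 f'.2|)) := by
          refine Finset.sum_le_sum fun f _ => Finset.sum_le_sum fun f' _ => ?_
          refine (abs_add_le _ _).trans (add_le_add le_rfl ?_)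
          refine (abs_sub _ _).trans (add_le_add ?_ ?_)
          · rw [abs_mul, hfl]
          · rw [abs_mul, hbg, mul_comm]
      _ = (∑ f ∈ S₁, ∑ f' ∈ S₂, |wedge (l.map fun q => (q.1 f.1 f.2, q.2 f'.1 f'.2))|)
            + ((∑ f ∈ S₁, |q.1 f.1 f.2|) * (∑ f' ∈ S₂, |((l.map Prod.snd).map fun p => p f'.1 f'.2).sum|)
              + (∑ f ∈ S₁, |((l.map Prod.fst).map fun p => p f.1 f.2).sum|) * (∑ f' ∈ S₂, |q.2 f'.1 f'.2|)) := by
          rw [Finset.sum_mul_sum, Finset.sum_mul_sum, ← Finset.sum_add_distrib, ← Finset.sum_add_distrib]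
          refine Finset.sum_congr rfl fun f _ => ?_
          rw [← Finset.sum_add_distrib, ← Finset.sum_add_distrib]
      _ ≤ (l.length : ℤ) ^ 2 + (1 * (l.length : ℤ) + (l.length : ℤ) * 1) :=
          add_le_add ih (add_le_add (mul_le_mul hq1 hA hAn zero_le_one) (mul_le_mul hB hq2 hq2n hlen))
      _ ≤ ((l.length : ℤ) + 1) ^ 2 := by nlinarith

/-! ## §2 The letter words of the symmetrised Hessian count read through the universal indicator form -/

section Universal

open Summit.QuantumFields.BalabanUV.Beta.SymAveragingHessianCounts (gammaPAt loopPAt gammaPAt_map loopPAt_map symLinU symLinCountAt symWedgeCountAt symHessCountAt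
  symHessKerAt lettersIn_gammaPAt lettersIn_loopPAt loopPAt_length_le_ell gammaPAt_length_le_ell card_box)
open Summit.QuantumFields.BalabanUV.Beta.SymmetrisedAxialPotential (card_perm_fin)
open Literature.MathematicalPhysics.QuantumFieldTheory.Balaban1983to89.Beta.AveragingHessianKernelsRooted (cCountAt lettersIn_cSegAt)
open Literature.MathematicalPhysics.QuantumFieldTheory.Balaban1983to89.Beta.AveragingContours (segUp segUp_length)

variable {L : ℕ} {r : Fin d → ℕ}

/-- [folklore] Evaluation of a `ℤ`-valued 1-form at a bond is additive; the indicator `δ1 f` is the universal indicator form `(κ, x) ↦ δ1 (κ, x)` read at `f`. -/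
theorem δ1_eq_mapForm_eval (f : Bond d) :
    δ1 f = mapForm ((Pi.evalAddMonoidHom (fun _ : (Fin d → ℤ) => ℤ) f.2).comp (Pi.evalAddMonoidHom (fun _ : Fin d => (Fin d → ℤ) → ℤ) f.1))
      (fun κ x => δ1 (κ, x)) := by
  funext κ x
  simp only [mapForm_apply, AddMonoidHom.coe_comp, Function.comp_apply, Pi.evalAddMonoidHom_apply, δ1_apply, Prod.mk.eta]
  by_cases h : (κ, x) = f
  · subst h; simp
  · rw [if_neg h, if_neg (Ne.symm h)]

/-- [folklore] The pair indicator form is the universal pair form read at `(f, f′)`. -/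
theorem pairForm_δ1_eq_mapForm_eval (f f' : Bond d) :
    pairForm (δ1 f) (δ1 f') = mapForm
      (((Pi.evalAddMonoidHom (fun _ : (Fin d → ℤ) => ℤ) f.2).comp (Pi.evalAddMonoidHom (fun _ : Fin d => (Fin d → ℤ) → ℤ) f.1)).prodMap
        ((Pi.evalAddMonoidHom (fun _ : (Fin d → ℤ) => ℤ) f'.2).comp (Pi.evalAddMonoidHom (fun _ : Fin d => (Fin d → ℤ) → ℤ) f'.1)))
      (pairForm (fun κ x => δ1 (κ, x)) (fun κ x => δ1 (κ, x))) := by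
  funext κ x
  simp only [mapForm_apply, pairForm_apply, AddMonoidHom.prodMap, AddMonoidHom.prod_apply, AddMonoidHom.coe_comp, Function.comp_apply,
    AddMonoidHom.coe_fst, AddMonoidHom.coe_snd, Pi.evalAddMonoidHom_apply, δ1_apply, Prod.mk.eta, Prod.mk.injEq]
  constructor
  · by_cases h : (κ, x) = f
    · subst h; simp
    · rw [if_neg h, if_neg (Ne.symm h)]
  · by_cases h : (κ, x) = f'
    · subst h; simp
    · rw [if_neg h, if_neg (Ne.symm h)]

/-- [folklore] Letters of the universal indicator form: `±δ1 (κ, x)`. -/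
theorem letters_of_lettersIn_univ {P : (Fin d → ℤ) → Prop} {l : List (Form1 d ℤ)} (h : LettersIn (fun κ x => δ1 (κ, x)) P l) :
    ∀ q ∈ l, ∃ g : Bond d, q = δ1 g ∨ q = -δ1 g := by
  intro q hq
  obtain ⟨κ, x, -, hq⟩ := h q hq
  exact ⟨(κ, x), hq⟩

/-- [folklore] Letters of the universal pair form: `±(δ1 (κ, x), δ1 (κ, x))`. -/
theorem letters_of_lettersIn_univ_pair {P : (Fin d → ℤ) → Prop} {l : List (Form1 d ℤ × Form1 d ℤ)}
    (h : LettersIn (pairForm (fun κ x => δ1 (κ, x)) (fun κ x => δ1 (κ, x))) P l) :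
    ∀ q ∈ l, ∃ g : Bond d, q = (δ1 g, δ1 g) ∨ q = (-δ1 g, -δ1 g) := by
  intro q hq
  obtain ⟨κ, x, -, hq⟩ := h q hq
  refine ⟨(κ, x), ?_⟩
  rcases hq with hq | hq
  · exact Or.inl (by rw [hq, pairForm_apply])
  · exact Or.inr (by rw [hq, pairForm_apply, Prod.neg_mk])

/-- [folklore] **PAIR MASS OF THE PAIR-LOOP WEDGE**: `Σ_{f ∈ S₁} Σ_{f′ ∈ S₂} |wedge (loop^{σ,σ′}_x(δ_f, δ_{f′}))| ≤ ℓ²` (box root, base point in the block). -/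
theorem sum_sum_abs_wedge_loopPAt_le (hL : 1 ≤ L) (hr : r ∈ box d L) (σ σ' : Equiv.Perm (Fin d)) (μ : Fin d) (y : Site d) {b : Fin d → ℕ}
    (hb : b ∈ box d L) (S₁ S₂ : Finset (Bond d)) :
    ∑ f ∈ S₁, ∑ f' ∈ S₂, |wedge (loopPAt σ σ' (toSite r) (pairForm (δ1 f) (δ1 f')) L μ y b)| ≤ (ell d L : ℤ) ^ 2 := by
  set l₀ := loopPAt σ σ' (toSite r) (pairForm (fun κ x => δ1 (κ, x)) (fun κ x => δ1 (κ, x))) L μ y b with hl₀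
  have hlet := letters_of_lettersIn_univ_pair (lettersIn_loopPAt σ σ' (pairForm (fun κ x => δ1 (κ, x)) (fun κ x => δ1 (κ, x))) L μ y hr hb)
  have hlen : (l₀.length : ℤ) ≤ ell d L := by exact_mod_cast loopPAt_length_le_ell σ σ' _ hL μ y hr hb
  have hre : ∀ f f' : Bond d, loopPAt σ σ' (toSite r) (pairForm (δ1 f) (δ1 f')) L μ y b = l₀.map fun q => (q.1 f.1 f.2, q.2 f'.1 f'.2) := by
    intro f f'
    rw [pairForm_δ1_eq_mapForm_eval, ← loopPAt_map]
    rfl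
  simp_rw [hre]
  exact (sum_sum_abs_wedge_le_sq S₁ S₂ l₀ hlet).trans (pow_le_pow_left₀ (by positivity) hlen 2)

/-- [folklore] **PAIR MASS OF THE STRAIGHT-SEGMENT WEDGE**: `Σ_{f ∈ S₁} Σ_{f′ ∈ S₂} |wedge (c(δ_f, δ_{f′}))| ≤ L²` (rooted segment). -/
theorem sum_sum_abs_wedge_segUp_le (hr : r ∈ box d L) (μ : Fin d) (y : Site d) (S₁ S₂ : Finset (Bond d)) :
    ∑ f ∈ S₁, ∑ f' ∈ S₂, |wedge (segUp (pairForm (δ1 f) (δ1 f')) ((L : ℤ) • y + toSite r) μ L)| ≤ (L : ℤ) ^ 2 := by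
  set l₀ := segUp (pairForm (fun κ x => δ1 (κ, x)) (fun κ x => δ1 (κ, x))) ((L : ℤ) • y + toSite r) μ L with hl₀
  have hlet := letters_of_lettersIn_univ_pair (lettersIn_cSegAt (pairForm (fun κ x => δ1 (κ, x)) (fun κ x => δ1 (κ, x))) L μ y hr)
  have hlen : (l₀.length : ℤ) = L := by rw [hl₀, segUp_length]
  have hre : ∀ f f' : Bond d, segUp (pairForm (δ1 f) (δ1 f')) ((L : ℤ) • y + toSite r) μ L = l₀.map fun q => (q.1 f.1 f.2, q.2 f'.1 f'.2) := by
    intro f f'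
    rw [pairForm_δ1_eq_mapForm_eval, ← segUp_map]
    rfl
  simp_rw [hre]
  exact (sum_sum_abs_wedge_le_sq S₁ S₂ l₀ hlet).trans (le_of_eq (by rw [hlen]))


/-! ## §3 The pair `ℓ¹` mass of the symmetrised Hessian count and kernel: the SAME number that bounds one entry -/

/-- [folklore] **PAIR MASS OF `WED⁰⁴`**: `Σ_{f ∈ S₁} Σ_{f′ ∈ S₂} |symWedgeCountAt ρ L μ y f f′| ≤ (d!)²·(L^d·ℓ²)` — `L^d` base points × `(d!)²` order pairs × `ℓ²` per loop. -/
theorem sum_sum_abs_symWedgeCountAt_le (hL : 1 ≤ L) (hr : r ∈ box d L) (μ : Fin d) (y : Site d) (S₁ S₂ : Finset (Bond d)) :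
    ∑ f ∈ S₁, ∑ f' ∈ S₂, |symWedgeCountAt (toSite r) L μ y f f'| ≤ (d ! : ℤ) ^ 2 * ((L : ℤ) ^ d * (ell d L : ℤ) ^ 2) := by
  classical
  -- one index for (b, σ, σ′)
  set T : Finset ((Fin d → ℕ) × (Equiv.Perm (Fin d) × Equiv.Perm (Fin d))) := box d L ×ˢ (Finset.univ ×ˢ Finset.univ) with hT
  have hW : ∀ f f' : Bond d, symWedgeCountAt (toSite r) L μ y f f'
      = ∑ t ∈ T, wedge (loopPAt t.2.1 t.2.2 (toSite r) (pairForm (δ1 f) (δ1 f')) L μ y t.1) := by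
    intro f f'
    simp only [symWedgeCountAt, hT, Finset.sum_product]
  have hTcard : (T.card : ℤ) = (L : ℤ) ^ d * (d ! : ℤ) ^ 2 := by
    rw [hT, Finset.card_product, Finset.card_product, card_box, Finset.card_univ, card_perm_fin]
    push_cast; ring
  calc ∑ f ∈ S₁, ∑ f' ∈ S₂, |symWedgeCountAt (toSite r) L μ y f f'|
      ≤ ∑ f ∈ S₁, ∑ f' ∈ S₂, ∑ t ∈ T, |wedge (loopPAt t.2.1 t.2.2 (toSite r) (pairForm (δ1 f) (δ1 f')) L μ y t.1)| :=
        Finset.sum_le_sum fun f _ => Finset.sum_le_sum fun f' _ => by rw [hW]; exact Finset.abs_sum_le_sum_abs _ _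
    _ = ∑ t ∈ T, ∑ f ∈ S₁, ∑ f' ∈ S₂, |wedge (loopPAt t.2.1 t.2.2 (toSite r) (pairForm (δ1 f) (δ1 f')) L μ y t.1)| := by
        have h1 : ∀ f : Bond d, ∑ f' ∈ S₂, ∑ t ∈ T, |wedge (loopPAt t.2.1 t.2.2 (toSite r) (pairForm (δ1 f) (δ1 f')) L μ y t.1)|
            = ∑ t ∈ T, ∑ f' ∈ S₂, |wedge (loopPAt t.2.1 t.2.2 (toSite r) (pairForm (δ1 f) (δ1 f')) L μ y t.1)| := fun f => Finset.sum_comm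
        rw [Finset.sum_congr rfl (fun f _ => h1 f), Finset.sum_comm]
    _ ≤ ∑ _t ∈ T, (ell d L : ℤ) ^ 2 :=
        Finset.sum_le_sum fun t ht => by
          have hb : t.1 ∈ box d L := (Finset.mem_product.1 (by rw [hT] at ht; exact ht)).1
          exact sum_sum_abs_wedge_loopPAt_le hL hr t.2.1 t.2.2 μ y hb S₁ S₂
    _ = (d ! : ℤ) ^ 2 * ((L : ℤ) ^ d * (ell d L : ℤ) ^ 2) := by
        rw [Finset.sum_const, nsmul_eq_mul, hTcard]; ring

/-- [folklore] **SINGLE MASS OF `LIN⁰⁴`**: `Σ_{f ∈ S} |symLinCountAt ρ L μ y f| ≤ d!·(L^d·ℓ)`. -/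
theorem sum_abs_symLinCountAt_le (hL : 1 ≤ L) (hr : r ∈ box d L) (μ : Fin d) (y : Site d) (S : Finset (Bond d)) :
    ∑ f ∈ S, |symLinCountAt (toSite r) L μ y f| ≤ (d ! : ℤ) * ((L : ℤ) ^ d * (ell d L : ℤ)) := by
  classical
  set T : Finset (Equiv.Perm (Fin d) × (Fin d → ℕ)) := Finset.univ ×ˢ box d L with hT
  have hre : ∀ (σ : Equiv.Perm (Fin d)) (b : Fin d → ℕ) (f : Bond d), (gammaPAt σ σ (toSite r) (δ1 f) L μ y b).sum
      = ((gammaPAt σ σ (toSite r) (fun κ x => δ1 (κ, x)) L μ y b).map fun q => q f.1 f.2).sum := by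
    intro σ b f
    rw [δ1_eq_mapForm_eval, ← gammaPAt_map]
    rfl
  have hW : ∀ f : Bond d, symLinCountAt (toSite r) L μ y f = ∑ t ∈ T, (gammaPAt t.1 t.1 (toSite r) (δ1 f) L μ y t.2).sum := by
    intro f
    simp only [symLinCountAt, symLinU, hT, Finset.sum_product]
  have hTcard : (T.card : ℤ) = (d ! : ℤ) * (L : ℤ) ^ d := by
    rw [hT, Finset.card_product, card_box, Finset.card_univ, card_perm_fin]; push_cast; ring
  calc ∑ f ∈ S, |symLinCountAt (toSite r) L μ y f|
      ≤ ∑ f ∈ S, ∑ t ∈ T, |(gammaPAt t.1 t.1 (toSite r) (δ1 f) L μ y t.2).sum| :=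
        Finset.sum_le_sum fun f _ => by rw [hW]; exact Finset.abs_sum_le_sum_abs _ _
    _ = ∑ t ∈ T, ∑ f ∈ S, |(gammaPAt t.1 t.1 (toSite r) (δ1 f) L μ y t.2).sum| := Finset.sum_comm
    _ ≤ ∑ _t ∈ T, (ell d L : ℤ) :=
        Finset.sum_le_sum fun t ht => by
          have hb : t.2 ∈ box d L := (Finset.mem_product.1 (by rw [hT] at ht; exact ht)).2
          simp_rw [hre t.1 t.2]
          refine (sum_abs_sum_eval_le_length S _ (letters_of_lettersIn_univ (lettersIn_gammaPAt t.1 t.1 _ L μ y hr hb))).trans ?_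
          exact_mod_cast gammaPAt_length_le_ell t.1 t.1 _ hL μ y hr hb
    _ = (d ! : ℤ) * ((L : ℤ) ^ d * (ell d L : ℤ)) := by
        rw [Finset.sum_const, nsmul_eq_mul, hTcard]; ring

/-- [folklore] **SINGLE MASS OF THE STRAIGHT COUNT**: `Σ_{f ∈ S} |cCountAt ρ L μ y f| ≤ L`. -/
theorem sum_abs_cCountAt_le (hr : r ∈ box d L) (μ : Fin d) (y : Site d) (S : Finset (Bond d)) :
    ∑ f ∈ S, |cCountAt (toSite r) L μ y f| ≤ (L : ℤ) := by
  have hre : ∀ f : Bond d, cCountAt (toSite r) L μ y f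
      = ((segUp (fun κ x => δ1 (κ, x)) ((L : ℤ) • y + toSite r) μ L).map fun q => q f.1 f.2).sum := by
    intro f
    rw [cCountAt, δ1_eq_mapForm_eval, ← segUp_map]
    rfl
  simp_rw [hre]
  refine (sum_abs_sum_eval_le_length S _ (letters_of_lettersIn_univ (lettersIn_cSegAt (fun κ x => δ1 (κ, x)) L μ y hr))).trans ?_
  rw [segUp_length]

/-- [folklore] **PAIR MASS OF `HESS⁰⁴`: `Σ_{f ∈ S₁} Σ_{f′ ∈ S₂} |symHessCountAt ρ L μ y f f′| ≤ 4·(d!)²·L^d·ℓ²` — THE SAME NUMBER THAT BOUNDS ONE ENTRY** (an1's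
`abs_symHessCountAt_le`): wedge `(d!)²L^dℓ²` + linear × straight `2·d!·(d!L^dℓ)·L` + straight wedge `(d!)²L^d·L²`, and `L ≤ ℓ`. -/
theorem sum_sum_abs_symHessCountAt_le (hL : 1 ≤ L) (hr : r ∈ box d L) (μ : Fin d) (y : Site d) (S₁ S₂ : Finset (Bond d)) :
    ∑ f ∈ S₁, ∑ f' ∈ S₂, |symHessCountAt (toSite r) L μ y f f'| ≤ 4 * (d ! : ℤ) ^ 2 * (L : ℤ) ^ d * (ell d L : ℤ) ^ 2 := by
  have hℓ : (L : ℤ) ≤ ell d L := by exact_mod_cast le_ell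
  have hL0 : (0 : ℤ) ≤ L := by positivity
  have hLd : (0 : ℤ) ≤ (L : ℤ) ^ d := by positivity
  have hfac : (0 : ℤ) ≤ d ! := by positivity
  have hW := sum_sum_abs_symWedgeCountAt_le hL hr μ y S₁ S₂
  have hA₁ := sum_abs_symLinCountAt_le hL hr μ y S₁
  have hA₂ := sum_abs_symLinCountAt_le hL hr μ y S₂
  have hC₁ := sum_abs_cCountAt_le hr μ y S₁
  have hC₂ := sum_abs_cCountAt_le hr μ y S₂
  have hS := sum_sum_abs_wedge_segUp_le (L := L) hr μ y S₁ S₂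
  have hA₁n : 0 ≤ ∑ f ∈ S₁, |symLinCountAt (toSite r) L μ y f| := Finset.sum_nonneg fun _ _ => abs_nonneg _
  have hA₂n : 0 ≤ ∑ f ∈ S₂, |symLinCountAt (toSite r) L μ y f| := Finset.sum_nonneg fun _ _ => abs_nonneg _
  have hC₁n : 0 ≤ ∑ f ∈ S₁, |cCountAt (toSite r) L μ y f| := Finset.sum_nonneg fun _ _ => abs_nonneg _
  have hC₂n : 0 ≤ ∑ f ∈ S₂, |cCountAt (toSite r) L μ y f| := Finset.sum_nonneg fun _ _ => abs_nonneg _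
  -- termwise triangle inequality
  have hterm : ∀ f f' : Bond d, |symHessCountAt (toSite r) L μ y f f'|
      ≤ |symWedgeCountAt (toSite r) L μ y f f'|
        + (d ! : ℤ) * (|symLinCountAt (toSite r) L μ y f| * |cCountAt (toSite r) L μ y f'|
            + |cCountAt (toSite r) L μ y f| * |symLinCountAt (toSite r) L μ y f'|)
        + (d ! : ℤ) ^ 2 * (L : ℤ) ^ d * |wedge (segUp (pairForm (δ1 f) (δ1 f')) ((L : ℤ) • y + toSite r) μ L)| := by
    intro f f'
    rw [symHessCountAt]
    refine (abs_add_le _ _).trans (add_le_add ((abs_add_le _ _).trans (add_le_add le_rfl ?_)) ?_)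
    · rw [abs_mul, abs_of_nonneg hfac]
      refine mul_le_mul_of_nonneg_left ?_ hfac
      refine (abs_sub _ _).trans (add_le_add ?_ ?_)
      · rw [abs_mul]
      · rw [abs_mul, mul_comm]
    · rw [abs_mul, abs_mul, abs_of_nonneg (pow_nonneg hfac 2), abs_of_nonneg hLd]
  calc ∑ f ∈ S₁, ∑ f' ∈ S₂, |symHessCountAt (toSite r) L μ y f f'|
      ≤ ∑ f ∈ S₁, ∑ f' ∈ S₂, (|symWedgeCountAt (toSite r) L μ y f f'|
        + (d ! : ℤ) * (|symLinCountAt (toSite r) L μ y f| * |cCountAt (toSite r) L μ y f'|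
            + |cCountAt (toSite r) L μ y f| * |symLinCountAt (toSite r) L μ y f'|)
        + (d ! : ℤ) ^ 2 * (L : ℤ) ^ d * |wedge (segUp (pairForm (δ1 f) (δ1 f')) ((L : ℤ) • y + toSite r) μ L)|) :=
        Finset.sum_le_sum fun f _ => Finset.sum_le_sum fun f' _ => hterm f f'
    _ = (∑ f ∈ S₁, ∑ f' ∈ S₂, |symWedgeCountAt (toSite r) L μ y f f'|)
        + (d ! : ℤ) * ((∑ f ∈ S₁, |symLinCountAt (toSite r) L μ y f|) * (∑ f' ∈ S₂, |cCountAt (toSite r) L μ y f'|)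
            + (∑ f ∈ S₁, |cCountAt (toSite r) L μ y f|) * (∑ f' ∈ S₂, |symLinCountAt (toSite r) L μ y f'|))
        + (d ! : ℤ) ^ 2 * (L : ℤ) ^ d
            * ∑ f ∈ S₁, ∑ f' ∈ S₂, |wedge (segUp (pairForm (δ1 f) (δ1 f')) ((L : ℤ) • y + toSite r) μ L)| := by
        rw [Finset.sum_mul_sum, Finset.sum_mul_sum, ← Finset.sum_add_distrib, Finset.mul_sum, Finset.mul_sum, ← Finset.sum_add_distrib,
          ← Finset.sum_add_distrib]
        refine Finset.sum_congr rfl fun f _ => ?_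
        rw [← Finset.sum_add_distrib, Finset.mul_sum, Finset.mul_sum, ← Finset.sum_add_distrib, ← Finset.sum_add_distrib]
    _ ≤ (d ! : ℤ) ^ 2 * ((L : ℤ) ^ d * (ell d L : ℤ) ^ 2)
        + (d ! : ℤ) * (((d ! : ℤ) * ((L : ℤ) ^ d * (ell d L : ℤ))) * (L : ℤ) + (L : ℤ) * ((d ! : ℤ) * ((L : ℤ) ^ d * (ell d L : ℤ))))
        + (d ! : ℤ) ^ 2 * (L : ℤ) ^ d * (L : ℤ) ^ 2 := by
        refine add_le_add (add_le_add hW (mul_le_mul_of_nonneg_left (add_le_add ?_ ?_) hfac)) (mul_le_mul_of_nonneg_left hS (by positivity))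
        · exact mul_le_mul hA₁ hC₂ hC₂n (hA₁n.trans hA₁)
        · exact mul_le_mul hC₁ hA₂ hA₂n hL0
    _ ≤ 4 * (d ! : ℤ) ^ 2 * (L : ℤ) ^ d * (ell d L : ℤ) ^ 2 := by
        have h1 : (L : ℤ) * (ell d L : ℤ) ≤ (ell d L : ℤ) ^ 2 := by nlinarith
        have h2 : (L : ℤ) ^ 2 ≤ (ell d L : ℤ) ^ 2 := pow_le_pow_left₀ hL0 hℓ 2
        nlinarith [mul_nonneg (pow_nonneg hfac 2) hLd]

/-- [folklore] **PAIR `ℓ¹` MASS OF THE SYMMETRISED AVERAGING HESSIAN TABLE: `Σ_{f ∈ S₁} Σ_{f′ ∈ S₂} |h^ρ_sym_{(μ,y)}(f, f′)| ≤ 2ℓ²`** (box root, `1 ≤ L`) — the SAME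
number as an1's entrywise `abs_symHessKerAt_le`: summing the table over ALL bond pairs costs nothing beyond ONE entry's bound. -/
theorem sum_sum_abs_symHessKerAt_le (hL : 1 ≤ L) (hr : r ∈ box d L) (μ : Fin d) (y : Site d) (S₁ S₂ : Finset (Bond d)) :
    ∑ f ∈ S₁, ∑ f' ∈ S₂, |symHessKerAt (toSite r) L μ y f f'| ≤ 2 * (ell d L : ℝ) ^ 2 := by
  have hfac : (0 : ℝ) < (d ! : ℝ) := by exact_mod_cast Nat.factorial_pos d
  have hden : (0 : ℝ) < 2 * (d ! : ℝ) ^ 2 * (L : ℝ) ^ d := by positivity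
  have h := sum_sum_abs_symHessCountAt_le hL hr μ y S₁ S₂
  have h' : (∑ f ∈ S₁, ∑ f' ∈ S₂, |(symHessCountAt (toSite r) L μ y f f' : ℝ)|) ≤ 4 * (d ! : ℝ) ^ 2 * (L : ℝ) ^ d * (ell d L : ℝ) ^ 2 := by
    exact_mod_cast h
  have e : ∀ f f' : Bond d, |symHessKerAt (toSite r) L μ y f f'| = |(symHessCountAt (toSite r) L μ y f f' : ℝ)| / (2 * (d ! : ℝ) ^ 2 * (L : ℝ) ^ d) := by
    intro f f'
    rw [symHessKerAt, abs_div, abs_of_pos hden]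
  simp_rw [e, ← Finset.sum_div]
  rw [div_le_iff₀ hden]
  nlinarith

end Universal


end Summit.QuantumFields.BalabanUV.Beta.D1BFx.SymHessTablePairMass

end
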